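import Summits.SmoothPoincare4.SmoothPoincare4.Theses.ZeroSurgeryExotic
import Literature.Uncategorized.Crux
import Literature.Topology.FourManifolds.Rasmussen
import Literature.Topology.FourManifolds.RasmussenConcordanceProofs
import Literature.Topology.FourManifolds.KnotsProofs
import Literature.Topology.FourManifolds.KirbyMovesMirrorProofs
import Literature.Topology.FourManifolds.ZeroSurgeryHomotopyBallSliceProofs
import Literature.Topology.FourManifolds.HomotopyBallSlice
import Literature.Topology.FourManifolds.OpenTrace
import Literature.Topology.FourManifolds.ConnectedSum
import Literature.Topology.FourManifolds.GaussDiagrams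
import Summits.SmoothPoincare4.SmoothPoincare4.Theorems.ZseSVanishesOnPairs.Negative.LoadBearing

/-!
# Line `lasagna-difference` — skeleton for crux `ZseSVanishesOnPairs` (stmt-SmoothPoincare4-0368)

Crux (FIXED; ledger signature verbatim = the tree's registered open statement
`Literature.Uncategorized.SVanishesOnPairs`, cf. `Cruxes/ZseSVanishesOnPairs/Disproof.lean` §0 — the route
decl `ZeroSurgeryExotic.ZseSVanishesOnPairs` is not materialised in the route file yet):
for knots `K, K'` with a common `0`-surgery `Y`, `K` smoothly slice, every Rasmussen invariant `s` of `K'` is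
`0`.

IDEA (card `Ideas/lasagna-difference.md`, triage r1: pass / fail-fold / pass-with-reservations).
The Manolescu–Piccirillo homotopy sphere `Z` of a pair is a DIFFERENCE OF TWO KNOT TRACES: for every
`S³`-representative `(m, k)` of the dual curve of `K'` one has the bi-filling identity
`X_k(m) ≅ X_k(m*) # Z` (♠).  Ren–Willis' lasagna `s`-invariant is additive under `#`, `≤ 0` in class `0`,
and EXACTLY `0` on a trace `X_k(m)` as soon as `k < -2·n₋(m)` (arXiv:2402.10452 Thm 1.13(1)); so one
diagrammatically negative presentation forces `s(Z; 0) = 0`, and the genus bound (Cor 4.15) for the slice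
disc of `K'` in `Z°` gives ONE inequality on `s(K')`.  The other inequality is the same statement for the
tree pair `(K, K̄', Y)` (the tree's `IsIntegralSurgery` is unoriented, so the class of pairs is closed under
`K' ↦ K̄'` with the SAME `Y`: `FramedLink.IsSurgery.mirror`), which is why no one-sided statement appears as
a stub (it would restate the crux).

STUBS (3, registered; `sorry` only inside them):
* `stub_traceDifferenceSupply` — (♠) + the slide orbit: on a `0`-surgery pair with `K` slice, `K'` is
  slice (tree convention: orientation-preserving ball chart `e`) in an oriented homotopy 4-sphere `(M, oM)`
  that is an oriented difference of open knot traces with ARBITRARILY NEGATIVE framing of the minuend.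
  Theorem-level (Manolescu–Piccirillo L3.3 construction, in tree; Nakamura arXiv:2203.14270 L3.5 inclusion
  `B' ⊂ X_k(m)` sharpened to (♠); slides over `K` move `k` by `±2`).  XL to formalise.
* `stub_negativeCrossingRace` — THE BET (hardest): a homotopy sphere with trace-difference presentations of
  arbitrarily negative framing has one whose framing beats `-2·n₋` of (a diagram of) its knot.
* `stub_lasagnaEngine` — Ren–Willis package, printed (Thm 1.13(1)/Cor 5.7, Thm 4.11(1),(4), Cor 4.15,
  Cor 4.18/4.19): a homotopy sphere that is an oriented trace difference with diagrammatically negative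
  minuend is `s`-NONNEGATIVE for knots slice in it w.r.t. an orientation-PRESERVING ball chart.  SIGN: the
  tree's `IsSliceDiscIn J M e f` reads `J` on `∂(removed ball) = -∂(M°)`, while RW/MMSW read knots on
  `∂(M°)` ("`S³ = -∂B⁴`", RW p. 3); hence tree-`J` = mirror of RW-`J` and the negative (`ℂℙ²bar`-type,
  lasagna-nonvanishing) world yields `0 ≤ s` here.  The composition below is sign-agnostic: flipping the
  conclusion to `s ≤ 0` leaves `ZseSVanishesOnPairs_of` intact (`omega` on the `K'`/`K̄'` pair).
COMPOSITION `ZseSVanishesOnPairs_of : Literature.Uncategorized.SVanishesOnPairs` (kernel-checked, no sorry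
of its own): supply → race → engine gives `0 ≤ s(K')`; the same for the tree pair `(K, K̄', Y)` gives
`0 ≤ -s(K')`.

DISPROOF USED (`Cruxes/ZseSVanishesOnPairs/Disproof.lean`, landed `Theorems/ZseSVanishesOnPairs/Negative/`):
honours `zseSVanishesOnPairs_false_without_slice` / `_commonSurgery` / `_surgeryLeft/Right` (all three enter
`stub_traceDifferenceSupply`: no slice disc ⇒ no exterior `E`, no common `Y` ⇒ no dual curve, no (♠)) and
`_false_without_invariant` (the invariant enters `stub_lasagnaEngine`); §1 calibration: the stubs imply
Rasmussen's slice theorem (expected of every line); §4: no stub weakens sliceness to topological / `s(K)=0`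
/ framing `m`; §5 (Gluck lever of the dead line `two-knot-meridional-dual`): this line makes NO statement on
the diffeomorphism type of `M` or of `M # ℂℙ²` (no exotic-Gluck bet, no sliceness collapse: a negative trace
never embeds in `S⁴`).

To re-audit: `ledger skeleton check <this file> --crux stmt-SmoothPoincare4-0368
  --crux-decl Literature.Uncategorized.SVanishesOnPairs`.
Once the planner restores `ZeroSurgeryExotic.ZseSVanishesOnPairs` (route edit + `import …Rasmussen`), add
`theorem ZseSVanishesOnPairs_of' : ZeroSurgeryExotic.ZseSVanishesOnPairs := ZseSVanishesOnPairs_of` and drop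
the `--crux-decl` override.
-/

noncomputable section

set_option linter.dupNamespace false

open scoped Manifold ContDiff Topology
open Set Function ContinuousMap
open Literature.Topology.FourManifolds

namespace Summit.SmoothPoincare4.SmoothPoincare4.Cruxes.ZseSVanishesOnPairs.LasagnaDifference

/-- Local notation: the model space `ℝⁿ`. -/
local notation "𝔼 " n:arg => EuclideanSpace ℝ (Fin n)
/-- Local notation: the round 4-sphere. -/
local notation "𝕊⁴" => (Metric.sphere (0 : EuclideanSpace ℝ (Fin 5)) 1)

/-! ## Definitions (interface of the line; no existence is smuggled in — all existence is in the stubs) -/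

/-- Number of negative crossings (local writhe `-1`) of a Gauss diagram. [cite: RenWillis2024, §1.4] -/
def negCrossings (G : GaussDiagram) : ℕ :=
  (Finset.univ.filter fun i : Fin G.n => G.sign i = -1).card

/-- **Diagrammatically negative framed knot** (Ren–Willis' nonvanishing certificate, arXiv:2402.10452
Thm 1.13(1) = Thm 5.5/Cor 5.7): some knot isotopic to `m` has a Gauss diagram `G` with `k < -2·n₋(G)`
(hence `k < -2·n₋(m)`), so that the lasagna `s`-invariant of the trace satisfies `s(X_k(m); 0) = 0`.
[cite: RenWillis2024, Thm. 1.13(1)] -/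
def IsDiagNegative (m : Knot) (k : ℤ) : Prop :=
  ∃ (m₀ : Knot) (G : GaussDiagram), m.IsIsotopic m₀ ∧ m₀.HasGaussDiagram G ∧
    k < -2 * (negCrossings G : ℤ)

/-- **Standard orientation of an open knot trace.** For a framed knot `(m, νm)` the tree's open trace
`νm.toTubeNbhd.OpenTrace` (`OpenTrace.lean`: `ℝ⁴ ∪` open 2-handle, framing = framing integer of `νm`) is
oriented by `oT` compatibly with its `0`-handle chart `inl : ℝ⁴ → T` (standard orientation of `ℝ⁴`).
[cite: Kirby1989, Ch. I §2] -/
def IsStdTraceOrientation {m : Knot} (νm : Knot.TubularNbhd m)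
    (oT : SmoothOrientation (𝓡 4) νm.toTubeNbhd.OpenTrace) : Prop :=
  IsOrientationPreserving (SmoothOrientation.euclidean 4) oT νm.toTubeNbhd.traceGlueData.inl

/-- **`(M, oM)` is an oriented difference of the knot traces of `(m, νm)` (minuend) and `(m', νm')`
(subtrahend)**: `X(m, νm) ≅ X(m', νm') # (M, oM)` as ORIENTED smooth manifolds, in the tree's relational
form `IsOrientedConnectedSum` (open traces with their standard orientations).  For the Manolescu–Piccirillo
sphere of a `0`-surgery pair and an `S³`-representative `(m, k)` of the dual curve this is the bi-filling
identity `X_k(m) ≅ X_k(m*) # Z` (♠). [cite: Nakamura2023, Lemma 3.5 (proof, the inclusion `B' ⊂ X_k(m)`)] -/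
def IsTraceDifference (M : Type) [TopologicalSpace M] [T2Space M] [ChartedSpace (𝔼 4) M]
    [IsManifold (𝓡 4) ∞ M] (oM : SmoothOrientation (𝓡 4) M)
    {m : Knot} (νm : Knot.TubularNbhd m) {m' : Knot} (νm' : Knot.TubularNbhd m') : Prop :=
  ∃ (oT : SmoothOrientation (𝓡 4) νm.toTubeNbhd.OpenTrace)
    (oT' : SmoothOrientation (𝓡 4) νm'.toTubeNbhd.OpenTrace),
    IsStdTraceOrientation νm oT ∧ IsStdTraceOrientation νm' oT' ∧ IsOrientedConnectedSum oT' oM oT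

/-- **Deep trace-difference presentations**: `(M, oM)` is an oriented difference of knot traces with
minuend framing below any prescribed bound (for the MP sphere: slide the representative downwards over
`K`, `k ↦ k - 2`). [cite: Nakamura2023, §3.2 p. 10 (slides over `K`)] -/
def HasDeepTraceDifferences (M : Type) [TopologicalSpace M] [T2Space M] [ChartedSpace (𝔼 4) M]
    [IsManifold (𝓡 4) ∞ M] (oM : SmoothOrientation (𝓡 4) M) : Prop :=
  ∀ N : ℕ, ∃ (m : Knot) (νm : Knot.TubularNbhd m) (k : ℤ) (m' : Knot) (νm' : Knot.TubularNbhd m'),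
    νm.HasFraming k ∧ k < -(N : ℤ) ∧ IsTraceDifference M oM νm νm'

/-- **Lasagna-visible presentation**: `(M, oM)` is an oriented difference of knot traces whose minuend is
diagrammatically negative (`k < -2·n₋`), so that Ren–Willis additivity `s(X_k(m);0) = s(X(m');0) + s(M;0)`
with all terms `≤ 0` and the left side `= 0` forces `s(M, oM; 0) = 0`. [cite: RenWillis2024, Thm. 4.11(4), Cor. 4.19, Thm. 1.13(1)] -/
def HasNegativeTraceDifference (M : Type) [TopologicalSpace M] [T2Space M] [ChartedSpace (𝔼 4) M]
    [IsManifold (𝓡 4) ∞ M] (oM : SmoothOrientation (𝓡 4) M) : Prop :=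
  ∃ (m : Knot) (νm : Knot.TubularNbhd m) (k : ℤ) (m' : Knot) (νm' : Knot.TubularNbhd m'),
    νm.HasFraming k ∧ IsDiagNegative m k ∧ IsTraceDifference M oM νm νm'

/-! ## The three registered stubs -/

/-- **Stub 1 — SUPPLY (♠ + slide orbit; theorem-level, XL to formalise).**  On a `0`-surgery pair
`(K, K', Y)` with `K` smoothly slice there is a closed smooth oriented homotopy 4-sphere `(M, oM)` in which
`K'` is slice with respect to an orientation-PRESERVING ball chart `e` (tree convention of
`Knot.IsSliceDiscIn`), and which is an oriented difference of open knot traces with arbitrarily negative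
minuend framing.  Proof route: `M = ±Z`, `Z = X₀(K') ∪_Y (B⁴ ∖ νD)` the Manolescu–Piccirillo sphere
(tree: `Knot.ManolescuPiccirillo2023_lemma33_sphere_construction`, `…_holds`), the sign chosen so that `K'`
(not `K̄'`) is slice w.r.t. an `oM`-positive chart; for every `S³`-representative `(m, k)` of the dual curve
of `K'`, `E ∪ h(c₀) ∪ h(c)` read from its two `S³`-fillings gives `X_k(m) ≅ X_k(m*) # Z` oriented (♠), and
for `-Z` the mirrored identity `X_{-k}(m̄) ≅ X_{-k}(m̄*) # (-Z)`; slides of the representative over `(K, 0)`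
change `k` by `±2`, so both signs admit presentations with framing `→ -∞`.  Uses the hypotheses
`K.IsSmoothlySlice` and both surgeries (Disproof §3: `_false_without_slice/_commonSurgery/_surgeryLeft/Right`).
[cite: ManolescuPiccirillo2023, Lemma 3.3] [cite: Nakamura2023, Lemma 3.5 and §3.2 p. 10] -/
theorem stub_traceDifferenceSupply :
    ∀ (K K' : Knot) (Y : Type) [TopologicalSpace Y] [ChartedSpace (𝔼 3) Y],
      IsIntegralSurgery (𝓡 3) Y K 0 → IsIntegralSurgery (𝓡 3) Y K' 0 → K.IsSmoothlySlice →
      ∃ (M : Type) (_ : TopologicalSpace M) (_ : T2Space M) (_ : SecondCountableTopology M)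
        (_ : ChartedSpace (𝔼 4) M) (_ : IsManifold (𝓡 4) ∞ M) (_ : CompactSpace M)
        (oM : SmoothOrientation (𝓡 4) M) (e : 𝔼 4 → M) (f : 𝔼 2 → M),
        Nonempty (M ≃ₕ 𝕊⁴) ∧ IsOrientationPreserving (SmoothOrientation.euclidean 4) oM e ∧
          K'.IsSliceDiscIn M e f ∧ HasDeepTraceDifferences M oM := by
  sorry

/-- **Stub 2 — THE BET (hardest): the framing outruns twice the negative crossing number.**  An oriented
homotopy 4-sphere that has trace-difference presentations with arbitrarily negative minuend framing has
one whose minuend is diagrammatically negative (`k < -2·n₋(G)` for some Gauss diagram `G` of a knot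
isotopic to `m`).  For `M = S⁴` true (`(U, -1)`).  For the MP sphere of a pair the intended supply is the
slide orbit `(m_j, k - 2j)` of ONE dual-curve representative (plus the freedom in `φ` and `D`); WARNING
(triage r1-2): for the Legendrian/diagrammatic band-sum realisation of a slide the crude count adds at
least one negative crossing per slide, so `k_j + 2n₋(D_j)` does not decrease along THAT sequence of
diagrams — a proof needs better diagrams of the band sums `m #_b K^∥` (or other presentations), a disproof
needs a homotopy sphere with deep presentations but `S²₀ = 0` (lasagna-invisible), i.e. essentially an
exotic sphere.  No statement about the diffeomorphism type of `M` is made. [cite: RenWillis2024, Thm. 1.13(1) and §6.1 Examples 6.1–6.3] [cite: Nakamura2023, §3.2 p. 10] -/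
theorem stub_negativeCrossingRace :
    ∀ (M : Type) [TopologicalSpace M] [T2Space M] [SecondCountableTopology M] [ChartedSpace (𝔼 4) M]
      [IsManifold (𝓡 4) ∞ M] [CompactSpace M], Nonempty (M ≃ₕ 𝕊⁴) →
      ∀ (oM : SmoothOrientation (𝓡 4) M), HasDeepTraceDifferences M oM →
        HasNegativeTraceDifference M oM := by
  sorry

/-- **Stub 3 — LASAGNA ENGINE (Ren–Willis, printed; XL to formalise: needs skein lasagna modules).**
If a closed smooth oriented homotopy 4-sphere `(M, oM)` is an oriented difference of knot traces
`X_k(m) ≅ X(m') # (M, oM)` with `k < -2·n₋(m)`, then every knot `J` that is slice in `M` with respect to an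
orientation-PRESERVING ball chart `e` has Rasmussen invariant `s ≥ 0`.  Printed chain
(arXiv:2402.10452): `s(X_k(m); 0) = 0` (Thm 1.13(1) = Cor 5.7, `n < -2n₋`); additivity under connected sum
with a closed summand, `s(X_k(m);0) = s(X(m');0) + s(M;0)` (Thm 4.11(4); equivalently Cor 4.18 for the
inclusion `M° ⊂ X_k(m)`), all three `≤ 0` (Cor 4.19) ⇒ `s(M; 0) = 0`; `M° = B⁴ # M` ⇒
`s(M°; J_RW; [f]) = s(B⁴; J_RW) + 0 = s_{gl₂}(J_RW) + 1` (Thm 4.11(1),(4)); genus bound for the disc `f`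
(Cor 4.15): `0 ≥ s_{gl₂}(J_RW) = -s(-J_RW)`, i.e. `s(J_RW) ≤ 0` for the knot READ ON `∂(M°)` (RW p. 3:
"`S³ = -∂B⁴`").  The tree's `IsSliceDiscIn J M e f` with `e` orientation preserving reads `J` on
`∂(e 𝔻⁴) = -∂(M°)`, so `J = -J_RW` (mirror) and `s(J) = -s(J_RW) ≥ 0`.  Consistency: MMSW
arXiv:1910.08195 Cor 6.13 (H-slice in `#ᵗℂℙ²bar` ⇒ `s ≤ 0` in the `∂(X°)` reading; `T_{2,-3}`, `s = -2`,
Ex. 6.4).  If the lead re-derives the opposite sign, replace `0 ≤ s` by `s ≤ 0`: `ZseSVanishesOnPairs_of`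
is unchanged.  Uses `K'.HasRasmussenInvariant s` (Disproof §3 `_false_without_invariant`).
[cite: RenWillis2024, Thm. 1.13(1), Thm. 4.11(1)(4), Cor. 4.15, Cor. 4.18, Cor. 4.19] [cite: ManolescuMarengonSarkarWillis2023, Cor. 6.13] -/
theorem stub_lasagnaEngine :
    ∀ (M : Type) [TopologicalSpace M] [T2Space M] [SecondCountableTopology M] [ChartedSpace (𝔼 4) M]
      [IsManifold (𝓡 4) ∞ M] [CompactSpace M], Nonempty (M ≃ₕ 𝕊⁴) →
      ∀ (oM : SmoothOrientation (𝓡 4) M), HasNegativeTraceDifference M oM →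
      ∀ (e : 𝔼 4 → M), IsOrientationPreserving (SmoothOrientation.euclidean 4) oM e →
      ∀ (J : Knot) (f : 𝔼 2 → M) (s : ℤ), J.IsSliceDiscIn M e f → J.HasRasmussenInvariant s →
        0 ≤ s := by
  sorry

/-! ## Glue (proved): mirror closure of tree pairs, and the composition -/

/-- **Tree pairs are closed under `K ↦ K̄` with the SAME `Y`**: the tree's `IsIntegralSurgery` is
unoriented, and `0`-surgery on the mirror is the orientation-reversed `0`-surgery
(`FramedLink.IsSurgery.mirror`, no separation hypotheses on `Y`). [cite: GompfStipsicz1999, §5.1] -/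
theorem isIntegralSurgery_mirror_zero {K : Knot} {Y : Type} [TopologicalSpace Y]
    [ChartedSpace (𝔼 3) Y] (h : IsIntegralSurgery (𝓡 3) Y K 0) :
    IsIntegralSurgery (𝓡 3) Y K.mirror 0 := by
  have h1 : (FramedLink.single K 0).IsSurgery (𝓡 3) Y := (FramedLink.isSurgery_single_iff K 0).2 h
  have h2 : (FramedLink.single K 0).mirror.IsSurgery (𝓡 3) Y := h1.mirror
  have h3 : (FramedLink.single K 0).mirror = FramedLink.single K.mirror 0 := by
    simp only [FramedLink.mirror, FramedLink.single]
    congr 1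
  rw [h3] at h2
  exact (FramedLink.isSurgery_single_iff K.mirror 0).1 h2

/-- **One side from the three stubs**: on a tree pair with `K` slice, `0 ≤ s(K')`. [folklore] -/
theorem rasmussen_nonneg_of_stubs (K K' : Knot) (Y : Type) [TopologicalSpace Y]
    [ChartedSpace (𝔼 3) Y] (s : ℤ) (h1 : IsIntegralSurgery (𝓡 3) Y K 0)
    (h2 : IsIntegralSurgery (𝓡 3) Y K' 0) (h3 : K.IsSmoothlySlice) (h4 : K'.HasRasmussenInvariant s) :
    0 ≤ s := by
  obtain ⟨M, _, _, _, _, _, _, oM, e, f, hM, he, hf, hdeep⟩ :=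
    stub_traceDifferenceSupply K K' Y h1 h2 h3
  exact stub_lasagnaEngine M hM oM (stub_negativeCrossingRace M hM oM hdeep) e he K' f s hf h4

/-- **COMPOSITION — the crux BY NAME** (`Literature.Uncategorized.SVanishesOnPairs` = ledger signature of
stmt-SmoothPoincare4-0368 verbatim; no `sorry` of its own — `sorryAx` enters only through the three
`stub_*`).  One side for `(K, K', Y)`, the other for the tree pair `(K, K̄', Y)`
(`isIntegralSurgery_mirror_zero`, `HasRasmussenInvariant.mirror_holds`: `s(K̄') = -s(K')`). [folklore] -/
theorem ZseSVanishesOnPairs_of : Literature.Uncategorized.SVanishesOnPairs := by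
  intro K K' Y _ _ s h1 h2 h3 h4
  have a : 0 ≤ s := rasmussen_nonneg_of_stubs K K' Y s h1 h2 h3 h4
  have b : 0 ≤ -s := rasmussen_nonneg_of_stubs K K'.mirror Y (-s) h1
    (isIntegralSurgery_mirror_zero h2) h3 (HasRasmussenInvariant.mirror_holds h4)
  omega

/-- The conclusion of `ZseSVanishesOnPairs_of`, spelled out: the ledger signature of
stmt-SmoothPoincare4-0368 verbatim (= the commented TODO decl `ZeroSurgeryExotic.ZseSVanishesOnPairs` of the
route file). [folklore] -/
theorem zseSVanishesOnPairs_signature :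
    ∀ (K K' : Literature.Topology.FourManifolds.Knot) (Y : Type) [TopologicalSpace Y]
      [ChartedSpace (EuclideanSpace ℝ (Fin 3)) Y] (s : ℤ),
      Literature.Topology.FourManifolds.IsIntegralSurgery (𝓡 3) Y K 0 →
      Literature.Topology.FourManifolds.IsIntegralSurgery (𝓡 3) Y K' 0 → K.IsSmoothlySlice →
      K'.HasRasmussenInvariant s → s = 0 :=
  ZseSVanishesOnPairs_of

/-! ## Sanity lemmas (proved): the interface is not vacuous on the standard sphere side of things -/

/-- The empty Gauss diagram has no negative crossings, so `(U, k)` is diagrammatically negative for every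
`k < 0` as soon as the unknot reads the empty diagram (named fact `Knot.unknot_hasGaussDiagram_empty`):
the certificate of `stub_lasagnaEngine` is met by `X_{-1}(U) = ℂℙ²bar°`-type traces. [cite: RenWillis2024, §6.1 Example 6.1] -/
theorem negCrossings_empty : negCrossings GaussDiagram.empty = 0 := by
  simp [negCrossings, GaussDiagram.empty]

/-- `IsDiagNegative` only gets easier as the framing decreases (the race of stub 2 is monotone in `k`).
[folklore] -/
theorem IsDiagNegative.mono {m : Knot} {k k' : ℤ} (h : IsDiagNegative m k) (hk : k' ≤ k) :
    IsDiagNegative m k' := by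
  obtain ⟨m₀, G, h₁, h₂, h₃⟩ := h
  exact ⟨m₀, G, h₁, h₂, lt_of_le_of_lt hk h₃⟩

/-- A lasagna-visible presentation is in particular a presentation (stub 2's conclusion refines, it does
not replace, the supply). [folklore] -/
theorem HasNegativeTraceDifference.exists_isTraceDifference {M : Type} [TopologicalSpace M] [T2Space M]
    [ChartedSpace (𝔼 4) M] [IsManifold (𝓡 4) ∞ M] {oM : SmoothOrientation (𝓡 4) M}
    (h : HasNegativeTraceDifference M oM) :
    ∃ (m : Knot) (νm : Knot.TubularNbhd m) (m' : Knot) (νm' : Knot.TubularNbhd m'),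
      IsTraceDifference M oM νm νm' := by
  obtain ⟨m, νm, -, m', νm', -, -, h⟩ := h
  exact ⟨m, νm, m', νm', h⟩

end Summit.SmoothPoincare4.SmoothPoincare4.Cruxes.ZseSVanishesOnPairs.LasagnaDifference

end
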